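import Mathlib
import Summits.NavierStokesRegularity.NavierStokesRegularity.Theorems.ScenarioCensusPeriodicSlabMeanFree
import Summits.NavierStokesRegularity.NavierStokesRegularity.Theorems.ScenarioCensusPeriodicSlabRadialFlux
import HarnessLib

/-!
# Census row S7, case (b): bounded periodic steady flows with axisymmetric radial velocity are
# axial constants (Bang–Gui–Wang–Xie 2025, Thm 1.4 (b))

Support file for the scenario census of `NavierStokesRegularity` (cell `pub/ns-census`, block S,
row S7 = Bang–Gui–Wang–Xie, J. Fluid Mech. 1005 (2025) A6 = arXiv:2205.13259, Thm 1.4; tree FACT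
`Literature.Analysis.FluidPDE.BangGuiWangXie2025_periodicSlab_liouville`, first conjunct, second
disjunct). **Theorem** (`periodicSlab_liouville_radialAxisymmetric`): for `ν > 0`, `L > 0`, a
smooth steady Navier–Stokes flow `(U, P)` on `ℝ³` (`IsLerayProfile ν 0 U P`, `U, P ∈ C^∞`),
bounded, axially `L`-periodic, whose radial velocity `u^r = radialVelocity U` is an axisymmetric
scalar ("`u^r` is independent of `θ`"), is an axial constant `U ≡ c e₃`.

Proof: the radial velocity has zero vertical period means
(`radial_verticalMean_eq_zero_of_radialVelocity_axisymmetric`, BGWX §6 Step 2, through the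
angular mean of the vertical period integral); hence `U` is constant
(`periodicSlab_liouville_of_radial_verticalMean`), and a constant field with axisymmetric `u^r` is
axial. No Bogovskiĭ map is used.

No summit statement is proved in this file; the census value of row S7 / a sub-row S7b is the
lead's call.

## References

* J. Bang, C. Gui, Y. Wang, C. Xie, arXiv:2205.13259, Thm 1.4 (b) and §6. [BangGuiWangXie2025]
-/

-- the summit and its single problem share the name (D-0017 nested layout)
set_option linter.dupNamespace false

noncomputable section

open MeasureTheory Set Function Filter
open scoped Topology InnerProductSpace RealInnerProductSpace

namespace Summit.NavierStokesRegularity.NavierStokesRegularity.Theorems.ScenarioCensus.PeriodicSlab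

open Literature.Analysis Literature.Analysis.FluidPDE
open Summit.NavierStokesRegularity.NavierStokesRegularity.Theorems.ScenarioCensus.HelicalSlab

/-- **Bang–Gui–Wang–Xie 2025, Thm 1.4 (b).** Let `ν > 0`, `L > 0`, and let `(U, P)` be a smooth
steady solution of the unforced Navier–Stokes system on `ℝ³` (`IsLerayProfile ν 0 U P`,
`U, P ∈ C^∞`), bounded and axially `L`-periodic, whose radial velocity `radialVelocity U = u^r` is
an axisymmetric scalar. Then `U ≡ c e₃` for some real `c`. -/
theorem periodicSlab_liouville_radialAxisymmetric {ν L : ℝ} (hν : 0 < ν) (hL : 0 < L)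
    {U : EuclideanSpace ℝ (Fin 3) → EuclideanSpace ℝ (Fin 3)} {P : EuclideanSpace ℝ (Fin 3) → ℝ}
    (hprof : IsLerayProfile ν 0 U P) (hU : ContDiff ℝ (⊤ : ℕ∞) U) (hP : ContDiff ℝ (⊤ : ℕ∞) P)
    (hbd : ∃ M : ℝ, ∀ x, ‖U x‖ ≤ M) (hper : IsAxiallyPeriodic L U)
    (hrad : IsAxisymmetricScalar (radialVelocity U)) :
    ∃ c : ℝ, U = fun _ => c • eZ := by
  obtain ⟨M, hM⟩ := hbd
  have hst : IsSteadyClassicalNS ν 0 U P := isSteadyClassicalNS_of_isLerayProfile hprof hU hP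
  obtain ⟨K₁, K₂, K₃, -, -, -, hK⟩ := steady_derivative_bounds hν hst hM
  have hU1 : ContDiff ℝ 1 U := contDiff_infty.1 hU 1
  have hmean := radial_verticalMean_eq_zero_of_radialVelocity_axisymmetric hU1 (fun x => (hK x).1)
    hst.divFree hper hrad
  obtain ⟨C, hC⟩ := periodicSlab_liouville_of_radial_verticalMean hν hL hprof hU hP ⟨M, hM⟩ hper hmean
  -- the constant has axisymmetric radial velocity, hence no horizontal part
  have hinv : ∀ θ x, ⟪horizPart (rotZ θ x), C⟫ = ⟪horizPart x, C⟫ := fun θ x => by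
    have h1 := inner_horizPart_eq_cylRadius_mul_radialVelocity U (rotZ θ x)
    have h2 := inner_horizPart_eq_cylRadius_mul_radialVelocity U x
    rw [cylRadius_rotZ, hrad θ x, ← h2] at h1
    simpa [hC] using h1
  have h1 := hinv Real.pi (EuclideanSpace.single 0 1)
  have h2 := hinv Real.pi (EuclideanSpace.single 1 1)
  simp [inner_horizPart_left, Real.cos_pi, Real.sin_pi] at h1 h2
  refine ⟨C 2, ?_⟩
  rw [hC]
  funext x
  ext i
  fin_cases i <;> simp [eZ] <;> linarith

end Summit.NavierStokesRegularity.NavierStokesRegularity.Theorems.ScenarioCensus.PeriodicSlab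

end
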